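import Summits.AnomalousDissipation.AnomalousDissipation.Theorems.EnsembleCeiling.Negative.SingleModeFat
import Summits.AnomalousDissipation.AnomalousDissipation.Theorems.TaylorCertificatesSteadyStatesLoudBoundedStubCompactnessSplit
import Literature.Analysis.FunctionSpaces.TorusHNegOnePairing
import Literature.Analysis.FunctionSpaces.TorusVectorParseval
import HarnessLib

/-!
# Every nonzero admissible force has a FAT SKELETON (tools lemma for the ceiling stub S2′ of line
# `lamb-floor-f123-shared-ceiling`, crux stmt-AnomalousDissipation-13038)

Line lead `prover-line-stmt-AnomalousDissipation-13038-c2-0` (2026-08-17). The strategist's typed fact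
`CensusSketchV3.EveryForceHasFatSkeleton` (STRATEGY-CENSUS v3 §T7), PROVED: for a smooth divergence-free
mean-zero force `f ≢ 0` on `T³` pick a frequency `k` with `f̂(k) ≠ 0` (Parseval; `k ≠ 0` by the zero mean);
the real divergence-free Fourier mode `M = Re(e_k f̂(k))` is a smooth steady Euler shear flow (its inertial
pairing against every smooth field vanishes, `inertial_mode`), `(M, f) = ‖f̂(k)‖² > 0`, and for the scaled
mode `sM`, `s = 1/(4π²|k|²)`, the spectral enstrophy `‖∇(sM)‖² = s²·4π²|k|²·½‖f̂(k)‖²` is at most the work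
`(sM, f) = s‖f̂(k)‖²`. So the `H`-lift `U` of `sM` is a NONZERO finite-enstrophy unforced steady weak Euler
state with `‖∇U‖² ≤ (U, f)` — the necessary condition for FAT steady branches delivered by the blow-down
(`stub_fatBlowDownTools`) is met by EVERY force: no steady/ensemble CEILING can be certified by first-order
blow-down rigidity (census v3 §T7, "decisive result"). Registered tools stub: `stub_fatSkeletonTools`
(last theorem, expanded signature). [folklore]
-/

noncomputable section

-- `Summit.<Summit>.<Problem>` is the tree's mandated summit-side namespace (CONVENTIONS §2); single-conjunct summit, duplicate deliberate.
set_option linter.dupNamespace false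

open MeasureTheory Filter Topology Matrix UnitAddTorus

namespace Summit.AnomalousDissipation.AnomalousDissipation.Theorems.SteadyStatesLoudBounded.FatSkeleton

open Literature.Analysis.FunctionSpaces Literature.Analysis.FunctionSpaces.Torus Literature.Analysis.FluidPDE
  Literature.Analysis.FluidPDE.Torus
open Summit.AnomalousDissipation.AnomalousDissipation.Theorems.SteadyStatesLoudBounded.CompactnessSplit
open Summit.AnomalousDissipation.AnomalousDissipation.Theorems.TaylorCertificatePair.Negative
open Summit.AnomalousDissipation.AnomalousDissipation.Theorems.EnsembleCeiling.Negative
open scoped InnerProductSpace ENNReal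

/-! ## A nonzero smooth mean-zero field has a nonzero Fourier mode at a nonzero frequency -/

/-- A continuous field that is nonzero somewhere has positive energy `∫ ‖f‖² > 0`. -/
theorem integral_norm_sq_pos {f : UnitAddTorus (Fin 3) → EuclideanSpace ℝ (Fin 3)} (hf : Continuous f)
    {x₀ : UnitAddTorus (Fin 3)} (hx₀ : f x₀ ≠ 0) : 0 < ∫ x, ‖f x‖ ^ 2 := by
  have hc : Continuous fun x => ‖f x‖ ^ 2 := (hf.norm).pow 2
  have hnn : 0 ≤ fun x => ‖f x‖ ^ 2 := fun x => sq_nonneg _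
  rw [integral_pos_iff_support_of_nonneg hnn hc.integrable_unitAddTorus]
  have hopen : IsOpen (Function.support fun x => ‖f x‖ ^ 2) := hc.isOpen_support
  refine hopen.measure_pos volume ⟨x₀, ?_⟩
  rw [Function.mem_support]
  exact pow_ne_zero 2 (norm_ne_zero_iff.2 hx₀)

/-- **A smooth mean-zero field `f ≢ 0` has a nonzero Fourier coefficient at a NONZERO frequency** (Parseval
`∫‖f‖² = ∑' ‖f̂(k)‖²`; the zero mode vanishes by the zero mean). -/
theorem exists_mFourierCoeff_ne_zero {f : UnitAddTorus (Fin 3) → EuclideanSpace ℝ (Fin 3)} (hf : IsSmooth f)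
    (hzm : HasZeroMean f) (h0 : ∃ x, f x ≠ 0) :
    ∃ k : Fin 3 → ℤ, k ≠ 0 ∧ mFourierCoeff (EuclideanSpace.complexify ∘ f) k ≠ 0 := by
  obtain ⟨x₀, hx₀⟩ := h0
  by_contra hall
  push Not at hall
  have hzero : ∀ k : Fin 3 → ℤ, mFourierCoeff (EuclideanSpace.complexify ∘ f) k = 0 := by
    intro k
    by_cases hk : k = 0
    · subst hk
      exact mFourierCoeff_complexify_zero_of_hasZeroMean hf.integrable hzm
    · exact hall k hk
  have hP := integral_norm_sq_eq_tsum (hf.memLp 2)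
  have hsum : ∑' k : Fin 3 → ℤ, ‖mFourierCoeff (EuclideanSpace.complexify ∘ f) k‖ ^ 2 = 0 := by
    rw [tsum_congr (fun k => by rw [hzero k, norm_zero, zero_pow two_ne_zero]), tsum_zero]
  rw [hsum] at hP
  exact absurd hP (integral_norm_sq_pos hf.continuous hx₀).ne'

/-! ## The fat skeleton of a force: a scaled Fourier mode -/

/-- `|k|² > 0` for a nonzero frequency. -/
theorem freqNormSq_pos {k : Fin 3 → ℤ} (hk : k ≠ 0) : 0 < freqNormSq k := by
  obtain ⟨i, hi⟩ : ∃ i, k i ≠ 0 := by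
    by_contra h
    push Not at h
    exact hk (funext h)
  unfold freqNormSq
  refine lt_of_lt_of_le ?_ (Finset.single_le_sum (fun j _ => sq_nonneg ((k j : ℝ))) (Finset.mem_univ i))
  have : (k i : ℝ) ≠ 0 := by exact_mod_cast hi
  positivity

/-- **`stub_fatSkeletonTools` — EVERY NONZERO ADMISSIBLE FORCE HAS A FAT SKELETON (tools stub, lead c2, for S2′).**
For a smooth divergence-free mean-zero `f : T³ → ℝ³` that is nonzero somewhere there is a state `U ∈ V ⊆ H`,
`U ≠ 0`, which is a steady weak solution of the UNFORCED Euler equations and satisfies the skeleton inequality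
`‖∇U‖² ≤ (U, f)` — the conclusion of the blow-down `stub_fatBlowDownTools` is met by every force. Witness:
the `H`-lift of `s Re(e_k f̂(k))` with `f̂(k) ≠ 0`, `k ≠ 0`, `s = 1/(4π²|k|²)`. -/
theorem stub_fatSkeletonTools :
    ∀ (f : UnitAddTorus (Fin 3) → EuclideanSpace ℝ (Fin 3)),
      Torus.IsSmooth f → Torus.IsDivFree f → Torus.HasZeroMean f → (∃ x, f x ≠ 0) →
      ∃ U : Torus.energySpace (Fin 3),
        (U : Lp (EuclideanSpace ℝ (Fin 3)) 2 (volume : Measure (UnitAddTorus (Fin 3)))) ∈ Torus.energySpaceV (Fin 3) ∧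
        Torus.IsSteadyWeakSolution 0 (fun _ => 0) U ∧ U ≠ 0 ∧
        (Torus.eGradNormSq ((U : Lp (EuclideanSpace ℝ (Fin 3)) 2 (volume : Measure (UnitAddTorus (Fin 3)))) :
            UnitAddTorus (Fin 3) → EuclideanSpace ℝ (Fin 3))).toReal ≤
          Torus.pairing (U : Lp (EuclideanSpace ℝ (Fin 3)) 2 (volume : Measure (UnitAddTorus (Fin 3)))) f := by
  intro f hf hdf hzm h0
  obtain ⟨k, hk, hck⟩ := exists_mFourierCoeff_ne_zero hf hzm h0
  set c : EuclideanSpace ℂ (Fin 3) := mFourierCoeff (EuclideanSpace.complexify ∘ f) k with hcdef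
  -- transversality `k · f̂(k) = 0` from `div f = 0`
  have htrans : ((fun j => ((k j : ℤ) : ℂ)) ⬝ᵥ (WithLp.ofLp c)) = 0 := by
    have h := hdf.isTransversal_mFourierCoeff hf {k} k (Finset.mem_singleton_self k)
    rw [hcdef]
    simpa [dotProduct] using h
  -- the scale `s = 1/(4π²|k|²)` and the scaled mode `M = Re(e_k (s c))`
  have hK : 0 < freqNormSq k := freqNormSq_pos hk
  set s : ℝ := 1 / (4 * Real.pi ^ 2 * freqNormSq k) with hsdef
  have hs : 0 < s := by positivity
  set z : EuclideanSpace ℂ (Fin 3) := (s : ℂ) • c with hzdef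
  have hz : ((fun j => ((k j : ℤ) : ℂ)) ⬝ᵥ (WithLp.ofLp z)) = 0 := by
    rw [hzdef, dotc_smul, htrans, mul_zero]
  have hz0 : z ≠ 0 := by
    rw [hzdef]
    exact smul_ne_zero (by exact_mod_cast hs.ne') hck
  obtain ⟨hMs, hMd, hMz, hME⟩ := singleMode_admissible hk hz
  set M : UnitAddTorus (Fin 3) → EuclideanSpace ℝ (Fin 3) := Torus.realTrigPoly {k} (fun _ => z) with hMdef
  -- the `H`-lift
  obtain ⟨U, hU⟩ := exists_lift hMs hMd hMz
  have hUG : eGradNormSq (U.1 : UnitAddTorus (Fin 3) → EuclideanSpace ℝ (Fin 3)) = ENNReal.ofReal (gradNormSq M) :=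
    eGradNormSq_of_lift hMs hU
  have hV : U.1 ∈ energySpaceV (Fin 3) := ⟨U.2,
    memSobolev_one_complexify_of_eGradNormSq_ne_top (Lp.memLp _) (by rw [hUG]; exact ENNReal.ofReal_ne_top)⟩
  -- (1) steady Euler: the generator at viscosity 0 and force 0 is the inertial pairing of the mode, which vanishes
  have hsol : IsSteadyWeakSolution 0 (fun _ => (0 : EuclideanSpace ℝ (Fin 3))) U := by
    intro w hw _ _
    unfold nsGeneratorPairing inertialPairing
    have h1 : ∫ x, ⟪(fun _ => (0 : EuclideanSpace ℝ (Fin 3))) x, w x⟫_ℝ = 0 := by simp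
    have h2 : ∫ x, ⟪Torus.fderiv w x ((U.1 : UnitAddTorus (Fin 3) → EuclideanSpace ℝ (Fin 3)) x),
        (U.1 : UnitAddTorus (Fin 3) → EuclideanSpace ℝ (Fin 3)) x⟫_ℝ = ∫ x, ⟪Torus.fderiv w x (M x), M x⟫_ℝ := by
      refine integral_congr_ae ?_
      filter_upwards [hU] with x hx
      rw [hx]
    rw [h1, zero_mul, h2, zero_add, zero_add]
    exact inertial_mode hz hw
  -- (2) nonzero: `‖U‖² = ∫‖M‖² = ½‖z‖² > 0`
  have hUne : U ≠ 0 := by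
    intro hU0
    have h1 : ‖U‖ ^ 2 = 2⁻¹ * ‖z‖ ^ 2 := by rw [norm_sq_of_lift hU, hME]
    rw [hU0, norm_zero, zero_pow two_ne_zero] at h1
    have h2 : 0 < ‖z‖ := norm_pos_iff.2 hz0
    nlinarith
  -- (3) the skeleton inequality
  have hpair : pairing U.1 f = s * ‖c‖ ^ 2 := by
    have h1 : pairing U.1 f = ∫ x, ⟪M x, f x⟫_ℝ := by
      unfold pairing
      refine integral_congr_ae ?_
      filter_upwards [hU] with x hx
      rw [hx]
    rw [h1, integral_inner_mode_left hf.integrable, ← hcdef, hzdef, inner_smul_left, Complex.conj_ofReal,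
      inner_self_eq_norm_sq_to_K]
    rw [Complex.re_ofReal_mul]
    congr 1
    norm_cast
  have hgrad : (eGradNormSq (U.1 : UnitAddTorus (Fin 3) → EuclideanSpace ℝ (Fin 3))).toReal ≤
      4 * Real.pi ^ 2 * freqNormSq k * (2⁻¹ * ‖z‖ ^ 2) := by
    rw [eGradNormSq_congr_ae_field hU, ← hME]
    exact toReal_eGradNormSq_mode_le k z
  have hznorm : ‖z‖ ^ 2 = s ^ 2 * ‖c‖ ^ 2 := by
    rw [hzdef, norm_smul, mul_pow]
    congr 1
    rw [Complex.norm_real, Real.norm_eq_abs, sq_abs]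
  refine ⟨U, hV, hsol, hUne, hgrad.trans ?_⟩
  rw [hpair, hznorm]
  -- `4π²|k|² · ½ · s² ‖c‖² = s‖c‖²/2 ≤ s‖c‖²`
  have hprod : 4 * Real.pi ^ 2 * freqNormSq k * s = 1 := by
    rw [hsdef]
    field_simp
  have hc2 : 0 ≤ ‖c‖ ^ 2 := sq_nonneg _
  nlinarith [hprod, hc2, hs]

end Summit.AnomalousDissipation.AnomalousDissipation.Theorems.SteadyStatesLoudBounded.FatSkeleton

end
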